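import Mathlib.Data.Finset.Sort
import Mathlib.Order.Interval.Finset.Fin
import Literature.ModelTheory.ExponentialFields.CylindricalDecomposition
import Literature.ModelTheory.ExponentialFields.TarskiSeidenbergProofs
import Literature.ModelTheory.ExponentialFields.ThomLemma
import Literature.NumberTheory.Transcendental.SemialgebraicMapsSmoothProofs
import HarnessLib

/-!
# Cylindrical decomposition adapted to finitely many semialgebraic sets (proof file)

Discharge of the named fact
`Literature.ModelTheory.ExponentialFields.IsSemialgebraic.exists_cylindricalDecomposition` of
`Literature/ModelTheory/ExponentialFields/CylindricalDecomposition.lean` (Basu–Pollack–Roy 2006,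
Thm. 5.6 "Cylindrical decomposition" and Cor. 5.7, for sets semialgebraic over a coefficient ring
`k`, i.e. *defined over* `D = image of k` in `ℝ`, §2.3): for every commutative ring `k` with an
algebra map `k → ℝ` and every finite family `F` of `k`-semialgebraic subsets of `ℝⁿ` there is a
cylindrical decomposition of `ℝⁿ` (Def. 5.1, `IsCylindricalDecomposition k n`) with
`k`-semialgebraic cells and continuous `k`-semialgebraic sections such that every member of `F` is
a union of cells. The theorem
`Literature.ModelTheory.ExponentialFields.IsSemialgebraic.exists_cylindricalDecomposition_holds`
at the end has literally the type `IsSemialgebraic.exists_cylindricalDecomposition k`; its axioms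
are the three standard ones.

## Proof architecture (Basu–Pollack–Roy §5.1 and §5.4, with Cohen–Hörmander elimination)

The printed proof of Thm. 5.6 (p. 214) is an induction on the dimension: a cylindrical
decomposition of `Rⁱ⁻¹` adapted to the elimination family `Elim_{Xᵢ}(𝒬)` (Not. 5.15, signed
subresultant coefficients) is lifted to `Rⁱ` by Thm. 5.16: over a connected
`Elim_{Xᵢ}(𝒬)`-invariant cell `S` the real roots of the non-zero `Q(x', Xᵢ)`, `Q ∈ 𝒬`, are given
by continuous semialgebraic functions `ξ₁ < ⋯ < ξ_ℓ` (Prop. 5.13–5.14: continuity of the roots in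
the coefficients, constancy of gcd degrees via subresultants, Prop. 4.24), whose graphs and bands
are `𝒬`-invariant; §5.4 (Lemma 5.33 = Thom's lemma, Thm. 5.34, Rem. 5.35) then describes the
cells by sign conditions once the families are closed under `∂/∂Xᵢ`. We follow exactly this
induction (`CylindricalDecomposition.exists_isCylindricalDecomposition_forall_sign_eq`, the
polynomial form Thm. 5.6; Cor. 5.7 from it through the sign-condition normal form
`IsSemialgebraic.exists_eq_setOf_signVec_mem`, as in Def. 5.5), with ONE deviation, forced by what
the tree provides (no subresultants, no continuity of complex roots), and documented here:

* **Elimination family.** Instead of `Elim_{Xᵢ}(𝒬)` we use the set of all coefficients of a finite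
  family `P ⊇ 𝒬` in `A[Y]`, `A = k[X₁, …, Xₙ]`, which is *stable* (closed under `∂/∂Y`, truncation
  and scaled pseudo-remainders; `SignDiagram.exists_isStable_supset`, the Cohen–Hörmander
  elimination already used for Tarski–Seidenberg in `TarskiSeidenbergProofs.lean`). By the
  parametric sign-diagram theorem `SignDiagram.isoDiag_specPairs` (tree), two points `x, x'` of
  `ℝⁿ` giving the same signs to these coefficients have specialised families `P_x, P_{x'} ⊆ ℝ[Y]`
  with isomorphic sign diagrams: an increasing bijection of their real root sets matching the signs
  of every member at corresponding roots and on corresponding gaps. Over a coefficient-invariant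
  cell `S` this gives at once the conclusions of Thm. 5.16: the number `ℓ` of roots is constant
  (`card_rts_eq`), the `j`-th root is carried to the `j`-th root (`apply_eq_of_strictMonoOn`),
  every member of `P` has constant sign on the graph of the `j`-th root `ξⱼ` and on each band
  (`sign_eval_apply_eq`, `sign_eval_eq_of_mem_band`) — no connectedness of `S` is needed.
* **Continuity of `ξⱼ` on `S`** (Thm. 5.16): by Rem. 5.35, `ξⱼ(x)` is throughout `S` a root of a
  fixed `g ∈ P` singled out by a fixed sign condition on the derivatives of `g` (which lie in `P`),
  of constant degree; the Thom-cell continuity argument of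
  `Literature.NumberTheory.Transcendental.continuousAt_of_thom_signs` (bounded roots + Thom's
  lemma `Thom.eq_singleton_of_mem`), here within `S` (`continuousWithinAt_of_thom_signs`).
* **Semialgebraicity of graphs and bands** (Thm. 5.34): over `S` the graph of `ξⱼ`, resp. the
  `j`-th band, is `{x' ∈ S} ∩ Reali(σ)` for the constant sign vector `σ` of `P` on it
  (`graphOver_eq_setOf_sign`, `bandOver_eq_setOf_sign`); the inclusion `⊇` is Thom's lemma for
  the derivative-closed family `P_x` (`Thom.isPreconnected_and_closure_eq` from the tree, in the
  forms `sign_eval_eq_of_mem_Icc`, `eq_of_eval_eq_zero_of_forall_sign_eq`,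
  `lt_iff_lt_of_forall_sign_eq`: distinct roots and gaps have distinct sign vectors).
* **The stack is a partition** of `ℝⁿ⁺¹` with non-empty cells (Def. 5.1 / Rem. 5.2;
  `isPartition_of_mem_iff`), the last variable being singled out through
  `q ↦ finSuccEquiv (rename (finRotate (n + 1)) q)` (`eval_map_finSuccEquiv_rename_finRotate`,
  `Fin.snoc_eq_cons_rotate`).

## Contents

* `CylindricalDecomposition.sign_eval_eq_of_mem_Icc`, `eq_of_eval_eq_zero_of_forall_sign_eq`,
  `lt_iff_lt_of_forall_sign_eq` — Thom's lemma for a finite family of real polynomials closed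
  under derivative (Lemma 5.33): sign vectors separate roots and gaps.
* `CylindricalDecomposition.exists_eq_apply_of_mem`, `apply_eq_of_strictMonoOn` — increasing
  enumerations of finite sets of reals (via Mathlib's `Finset.orderEmbOfFin_unique`);
  `mem_band_iff`, `exists_eq_or_exists_mem_band`, `band_eq_band`, `exists_mem_band` — the
  cells of a line cut by strictly increasing sections (`bandLower`/`bandUpper` conventions).
* `CylindricalDecomposition.continuousWithinAt_of_thom_signs` — continuity, within a set, of a
  root selected by a Thom sign condition.
* `CylindricalDecomposition.card_rts_eq`, `sign_eval_apply_eq`, `sign_eval_eq_of_mem_band`,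
  `continuousOn_section`, `graphOver_eq_setOf_sign`, `bandOver_eq_setOf_sign`,
  `isSemialgebraic_graphOver`, `isSemialgebraic_bandOver`, `isSemialgebraicFunOn_section`,
  `sign_eval_eq_of_mem_cell` — Thm. 5.16 over a set on which the coefficients of a stable family
  `P ⊆ k[X₁, …, Xₙ][Y]` have constant signs, for sections `ξ` enumerating increasingly the real
  roots `rts[P, x]` of the non-zero specialisations (stated for any such `ξ`; the sections are
  built with `Finset.orderEmbOfFin` in the inductive step).
* `CylindricalDecomposition.isPartition_of_mem_iff` (the stack over a partition is a partition),
  `exists_isCylindricalDecomposition_succ` (inductive step),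
  `exists_isCylindricalDecomposition_forall_sign_eq` (Thm. 5.6 over `k`),
  `IsSemialgebraic.exists_cylindricalDecomposition_holds` (Cor. 5.7 over `k`).

## References

* S. Basu, R. Pollack, M.-F. Roy, *Algorithms in Real Algebraic Geometry*, 2nd ed., Springer
  (2006): Def. 5.1, Rem. 5.2, Def. 5.5, Thm. 5.6, Cor. 5.7 (pp. 206–209 of the held copy);
  Prop. 5.14, Not. 5.15, Thm. 5.16 and the proof of Thm. 5.6 (pp. 212–214); Def. 5.32,
  Lemma 5.33 (Thom's lemma), Thm. 5.34, Rem. 5.35 (pp. 220–221).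
* J. Bochnak, M. Coste, M.-F. Roy, *Real Algebraic Geometry*, Ergebnisse 36, Springer (1998),
  §2.3 (cylindrical algebraic decomposition), Prop. 2.5.4 (Thom's lemma).
* P. J. Cohen, Decision procedures for real and `p`-adic fields, Comm. Pure Appl. Math. 22
  (1969), 131–151 (the elimination behind `SignDiagram`).

## Design notes

* Everything is over the ambient field `ℝ`, as the vendored fact (Mathlib has no `IsRealClosed ℝ`
  instance at the pin; the univariate analysis of `SignDiagram`/`ThomLemma` uses Mathlib's real
  IVT/MVT).
* No definitions and no new named facts: the root sets `rts[P, x]` (local notation for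
  `SignDiagram.rts` of the specialised family) and the sections are handled through hypotheses
  (`hm`: constant number of roots, `hξ`: `ξ · x` enumerates `rts[P, x]` increasingly), and the
  concrete sections/stack are `let`-bound inside `exists_isCylindricalDecomposition_succ`.
-/

noncomputable section

open Set Polynomial Filter
open _root_.Topology
open Literature.NumberTheory.Transcendental (IsSemialgebraicFunOn isSemialgebraicFunOn_iff)

namespace Literature.ModelTheory.ExponentialFields

namespace CylindricalDecomposition

/-! ### Thom's lemma for a family closed under derivative: sign vectors separate the line cells -/

section Line

variable {F : Finset ℝ[X]}

/-- A family of real polynomials closed under derivative is closed under iterated derivatives.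
[folklore] -/
theorem iterate_derivative_mem (hF : ∀ f ∈ F, derivative f ∈ F) {f : ℝ[X]} (hf : f ∈ F)
    (j : ℕ) : derivative^[j] f ∈ F := by
  induction j with
  | zero => exact hf
  | succ j ih => rw [Function.iterate_succ_apply']; exact hF _ ih

/-- **Thom's lemma, constancy form.** If a finite family of real polynomials is closed under
derivative and two points `t ≤ u` give the same sign to every member of the family, then every
member has that same sign at every point of `[t, u]` (the Thom cell of each member containing `t`
and `u` is an interval). [cite: BasuPollackRoy2006, Lemma 5.33 (Thom's lemma)] -/
theorem sign_eval_eq_of_mem_Icc (hF : ∀ f ∈ F, derivative f ∈ F) {t u : ℝ}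
    (h : ∀ f ∈ F, SignType.sign (f.eval t) = SignType.sign (f.eval u)) {v : ℝ}
    (hv : v ∈ Icc t u) {f : ℝ[X]} (hf : f ∈ F) :
    SignType.sign (f.eval v) = SignType.sign (f.eval t) := by
  set σ : ℕ → SignType := fun j => SignType.sign ((derivative^[j] f).eval t) with hσ
  have ht : t ∈ {y | ∀ j ≤ f.natDegree, SignType.sign ((derivative^[j] f).eval y) = σ j} :=
    fun j _ => rfl
  have hu : u ∈ {y | ∀ j ≤ f.natDegree, SignType.sign ((derivative^[j] f).eval y) = σ j} :=
    fun j _ => (h _ (iterate_derivative_mem hF hf j)).symm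
  obtain ⟨hconn, -⟩ := Thom.isPreconnected_and_closure_eq f.natDegree f σ rfl ⟨t, ht⟩
  exact (isPreconnected_iff_ordConnected.mp hconn).out ht hu hv 0 (Nat.zero_le _)

/-- **Thom's lemma, separation of roots.** In a finite family of real polynomials closed under
derivative, a root of a non-zero member does not give the same signs to all members as any other
point. [cite: BasuPollackRoy2006, Lemma 5.33 (Thom's lemma)] -/
theorem eq_of_eval_eq_zero_of_forall_sign_eq (hF : ∀ f ∈ F, derivative f ∈ F) {f : ℝ[X]}
    (hf : f ∈ F) (hf0 : f ≠ 0) {t u : ℝ} (hft : f.eval t = 0)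
    (h : ∀ g ∈ F, SignType.sign (g.eval t) = SignType.sign (g.eval u)) : t = u := by
  by_contra htu
  apply hf0
  apply Polynomial.eq_zero_of_infinite_isRoot
  have hfu : f.eval u = 0 := by
    have := h f hf
    rw [hft, sign_zero, eq_comm, sign_eq_zero_iff] at this
    exact this
  rcases lt_or_gt_of_ne htu with hlt | hlt
  · refine (Icc_infinite hlt).mono fun v hv => ?_
    have := sign_eval_eq_of_mem_Icc hF h hv hf
    rw [hft, sign_zero, sign_eq_zero_iff] at this
    exact this
  · refine (Icc_infinite hlt).mono fun v hv => ?_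
    have h' : ∀ g ∈ F, SignType.sign (g.eval u) = SignType.sign (g.eval t) :=
      fun g hg => (h g hg).symm
    have := sign_eval_eq_of_mem_Icc hF h' hv hf
    rw [hfu, sign_zero, sign_eq_zero_iff] at this
    exact this

/-- **Thom's lemma, separation of gaps.** In a finite family of real polynomials closed under
derivative, two points giving the same signs to all members, one of which is not a root of the
family, have the same roots of the family below them. [cite: BasuPollackRoy2006, Lemma 5.33 (Thom's lemma)] -/
theorem lt_iff_lt_of_forall_sign_eq (hF : ∀ f ∈ F, derivative f ∈ F) {t u : ℝ}
    (h : ∀ g ∈ F, SignType.sign (g.eval t) = SignType.sign (g.eval u))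
    (ht : t ∉ SignDiagram.rts F) {z : ℝ} (hz : z ∈ SignDiagram.rts F) : z < t ↔ z < u := by
  obtain ⟨f, hf, hf0, hfz⟩ := SignDiagram.mem_rts.mp hz
  have hft : f.eval t ≠ 0 := fun h0 => ht (SignDiagram.mem_rts.mpr ⟨f, hf, hf0, h0⟩)
  have key : z ∉ Icc (min t u) (max t u) := by
    intro hzI
    have hmin : ∀ g ∈ F,
        SignType.sign (g.eval (min t u)) = SignType.sign (g.eval (max t u)) := by
      intro g hg
      rcases le_total t u with htu | hut
      · rw [min_eq_left htu, max_eq_right htu]; exact h g hg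
      · rw [min_eq_right hut, max_eq_left hut]; exact (h g hg).symm
    have h1 := sign_eval_eq_of_mem_Icc hF hmin hzI hf
    rw [hfz, sign_zero] at h1
    rcases le_total t u with htu | hut
    · rw [min_eq_left htu] at h1
      exact hft (sign_eq_zero_iff.mp h1.symm)
    · rw [min_eq_right hut] at h1
      have h2 := h f hf
      rw [← h1, sign_eq_zero_iff] at h2
      exact hft h2
  rw [mem_Icc, not_and_or, not_le, not_le] at key
  rcases key with hlt | hlt
  · exact ⟨fun _ => lt_of_lt_of_le hlt (min_le_right _ _),
      fun _ => lt_of_lt_of_le hlt (min_le_left _ _)⟩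
  · exact ⟨fun h' => absurd (lt_of_le_of_lt (le_max_left _ _) hlt) (not_lt.mpr h'.le),
      fun h' => absurd (lt_of_le_of_lt (le_max_right _ _) hlt) (not_lt.mpr h'.le)⟩

end Line

/-! ### Increasing enumerations of a finite set of reals -/

section Enumeration

variable {Z : Finset ℝ} {m : ℕ} {a : Fin m → ℝ}

/-- Every element of a finite set of reals with `m` elements is a value of any strictly increasing
`m`-tuple of its elements. [folklore] -/
theorem exists_eq_apply_of_mem (h : Z.card = m) (ha : ∀ i, a i ∈ Z) (hmono : StrictMono a)
    {z : ℝ} (hz : z ∈ Z) : ∃ i : Fin m, z = a i := by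
  have : z ∈ Set.range (Z.orderEmbOfFin h) := by rw [Finset.range_orderEmbOfFin]; exact hz
  obtain ⟨i, hi⟩ := this
  exact ⟨i, by rw [Finset.orderEmbOfFin_unique h ha hmono, hi]⟩

/-- A strictly increasing map between two finite sets of reals of the same size carries
increasing enumerations to increasing enumerations. [folklore] -/
theorem apply_eq_of_strictMonoOn {Z' : Finset ℝ} {a' : Fin m → ℝ}
    (ha : ∀ i, a i ∈ Z) (hmono : StrictMono a) (h' : Z'.card = m) (ha' : ∀ i, a' i ∈ Z')
    (hmono' : StrictMono a') {e : ℝ → ℝ} (hmaps : Set.MapsTo e Z Z') (he : StrictMonoOn e Z)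
    (i : Fin m) : e (a i) = a' i := by
  have h1 : (fun j => e (a j)) = Z'.orderEmbOfFin h' :=
    Finset.orderEmbOfFin_unique h' (fun j => hmaps (ha j))
      (fun b c hbc => he (ha b) (ha c) (hmono hbc))
  rw [Finset.orderEmbOfFin_unique h' ha' hmono']
  exact congrFun h1 i

end Enumeration


/-! ### The cells of the line cut out by finitely many sections -/

section LineCells

variable {n l : ℕ} (ξ : Fin l → (Fin n → ℝ) → ℝ) (x : Fin n → ℝ)

/-- Membership in the `j`-th band in terms of comparisons with the sections: for strictly
increasing sections, `ξ_{j-1}(x) < t < ξ_j(x)` iff `t` is not a section value and the sections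
below `t` are exactly `ξ_0, …, ξ_{j-1}`. [cite: BasuPollackRoy2006, Def. 5.1] -/
theorem mem_band_iff (hmono : StrictMono fun i => ξ i x) (j : Fin (l + 1)) (t : ℝ) :
    (bandLower ξ j x < t ∧ (t : EReal) < bandUpper ξ j x) ↔
      (∀ i : Fin l, ξ i x ≠ t) ∧ ∀ i : Fin l, ξ i x < t ↔ (i : ℕ) < j := by
  constructor
  · rintro ⟨hlo, hup⟩
    have hlt : ∀ i : Fin l, (i : ℕ) < j → ξ i x < t := by
      intro i hi
      have hj0 : j ≠ 0 := fun h0 => by rw [h0] at hi; exact Nat.not_lt_zero _ hi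
      rw [bandLower_of_ne_zero ξ j hj0, EReal.coe_lt_coe_iff] at hlo
      refine lt_of_le_of_lt (hmono.monotone ?_) hlo
      rw [Fin.le_def, Fin.val_pred]
      exact Nat.le_pred_of_lt hi
    have hgt : ∀ i : Fin l, (j : ℕ) ≤ i → t < ξ i x := by
      intro i hi
      have hjl : j ≠ Fin.last l := fun hl => by
        rw [hl, Fin.val_last] at hi; exact absurd i.2 (not_lt.mpr hi)
      rw [bandUpper_of_ne_last ξ j hjl, EReal.coe_lt_coe_iff] at hup
      refine lt_of_lt_of_le hup (hmono.monotone ?_)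
      rw [Fin.le_def, Fin.coe_castPred]
      exact hi
    refine ⟨fun i => ?_, fun i => ⟨fun hi => ?_, hlt i⟩⟩
    · rcases lt_or_ge (i : ℕ) j with hi | hi
      · exact (hlt i hi).ne
      · exact (hgt i hi).ne'
    · by_contra hij
      exact absurd hi (not_lt.mpr (hgt i (not_lt.mp hij)).le)
  · rintro ⟨hne, hiff⟩
    constructor
    · by_cases hj0 : j = 0
      · rw [hj0, bandLower_zero]; exact EReal.bot_lt_coe t
      · rw [bandLower_of_ne_zero ξ j hj0, EReal.coe_lt_coe_iff, hiff, Fin.val_pred]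
        exact Nat.pred_lt (fun h0 => hj0 (Fin.ext h0))
    · by_cases hjl : j = Fin.last l
      · rw [hjl, bandUpper_last]; exact EReal.coe_lt_top t
      · rw [bandUpper_of_ne_last ξ j hjl, EReal.coe_lt_coe_iff]
        have h1 : ¬ ξ (j.castPred hjl) x < t := by rw [hiff, Fin.coe_castPred]; exact lt_irrefl _
        exact lt_of_le_of_ne (not_lt.mp h1) (hne _).symm

/-- Every real number is a section value or lies in a band (for strictly increasing sections).
[cite: BasuPollackRoy2006, Def. 5.1] -/
theorem exists_eq_or_exists_mem_band (hmono : StrictMono fun i => ξ i x) (t : ℝ) :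
    (∃ i : Fin l, t = ξ i x) ∨
      ∃ j : Fin (l + 1), bandLower ξ j x < t ∧ (t : EReal) < bandUpper ξ j x := by
  classical
  by_cases h : ∃ i : Fin l, t = ξ i x
  · exact Or.inl h
  · push Not at h
    right
    set c : ℕ := (Finset.univ.filter fun i : Fin l => ξ i x < t).card with hc
    have hcl : c ≤ l := by
      rw [hc]; exact (Finset.card_le_univ _).trans_eq (Fintype.card_fin l)
    refine ⟨⟨c, Nat.lt_succ_of_le hcl⟩, (mem_band_iff ξ x hmono _ t).mpr ⟨fun i => (h i).symm, ?_⟩⟩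
    intro i
    constructor
    · intro hi
      have hsub : Finset.Iic i ⊆ Finset.univ.filter fun i : Fin l => ξ i x < t := by
        intro i' hi'
        rw [Finset.mem_Iic] at hi'
        rw [Finset.mem_filter]
        exact ⟨Finset.mem_univ _, lt_of_le_of_lt (hmono.monotone hi') hi⟩
      have := Finset.card_le_card hsub
      rw [Fin.card_Iic] at this
      exact this
    · intro hi
      by_contra hit
      have hsub : (Finset.univ.filter fun i : Fin l => ξ i x < t) ⊆ Finset.Iio i := by
        intro i' hi'
        rw [Finset.mem_filter] at hi'
        rw [Finset.mem_Iio]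
        by_contra hii
        exact hit (lt_of_le_of_lt (hmono.monotone (not_lt.mp hii)) hi'.2)
      have := Finset.card_le_card hsub
      rw [Fin.card_Iio] at this
      exact absurd hi (not_lt.mpr this)

/-- Two bands containing a common point coincide. [cite: BasuPollackRoy2006, Def. 5.1] -/
theorem band_eq_band (hmono : StrictMono fun i => ξ i x) {j j' : Fin (l + 1)} {t : ℝ}
    (hj : bandLower ξ j x < t ∧ (t : EReal) < bandUpper ξ j x)
    (hj' : bandLower ξ j' x < t ∧ (t : EReal) < bandUpper ξ j' x) : j = j' := by
  rw [mem_band_iff ξ x hmono] at hj hj'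
  rcases lt_trichotomy j j' with h | h | h
  · have hjl : (j : ℕ) < l := lt_of_lt_of_le (Fin.lt_def.mp h) (Nat.lt_succ_iff.mp j'.2)
    have h1 := (hj'.2 ⟨j, hjl⟩).mpr h
    rw [hj.2 ⟨j, hjl⟩] at h1
    exact absurd h1 (lt_irrefl _)
  · exact h
  · have hjl : (j' : ℕ) < l := lt_of_lt_of_le (Fin.lt_def.mp h) (Nat.lt_succ_iff.mp j.2)
    have h1 := (hj.2 ⟨j', hjl⟩).mpr h
    rw [hj'.2 ⟨j', hjl⟩] at h1
    exact absurd h1 (lt_irrefl _)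

/-- A section value lies in no band. [cite: BasuPollackRoy2006, Def. 5.1] -/
theorem not_mem_band_of_eq (hmono : StrictMono fun i => ξ i x) {i : Fin l} {j : Fin (l + 1)}
    {t : ℝ} (hi : t = ξ i x) :
    ¬ (bandLower ξ j x < t ∧ (t : EReal) < bandUpper ξ j x) := by
  rw [mem_band_iff ξ x hmono]
  exact fun h => h.1 i hi.symm

/-- Every band is non-empty (for strictly increasing sections). [cite: BasuPollackRoy2006, Def. 5.1] -/
theorem exists_mem_band (hmono : StrictMono fun i => ξ i x) (j : Fin (l + 1)) :
    ∃ t : ℝ, bandLower ξ j x < t ∧ (t : EReal) < bandUpper ξ j x := by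
  apply EReal.exists_between_coe_real
  have hlo : ∀ j : Fin (l + 1), bandLower ξ j x < ⊤ := by
    intro j
    by_cases hj0 : j = 0
    · rw [hj0, bandLower_zero]; exact bot_lt_top
    · rw [bandLower_of_ne_zero ξ j hj0]; exact EReal.coe_lt_top _
  by_cases hjl : j = Fin.last l
  · rw [hjl, bandUpper_last]; exact hlo _
  · rw [bandUpper_of_ne_last ξ j hjl]
    by_cases hj0 : j = 0
    · have : bandLower ξ j x = ⊥ := by rw [hj0, bandLower_zero]
      rw [this]; exact EReal.bot_lt_coe _
    · rw [bandLower_of_ne_zero ξ j hj0, EReal.coe_lt_coe_iff]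
      apply hmono
      rw [Fin.lt_def, Fin.val_pred, Fin.coe_castPred]
      exact Nat.pred_lt (fun h0 => hj0 (Fin.ext h0))

end LineCells

/-! ### Continuity of a Thom-selected root within a set -/

section ThomContinuity

/-- **Continuity of a Thom-selected root, within a set.** Let `P x ∈ ℝ[Y]` depend on `x ∈ ℝ ^ m`
with jointly continuous derivatives `(x, y) ↦ (∂ʲP x)(y)` and continuous coefficients, and let `U`
be a set on which `P x ≠ 0` has constant degree `e` and the signs of all `(∂ʲP x)(f x)`, `j ≤ e`,
are a fixed vector `σ` with `σ 0 = 0` (so `f x` is a root of `P x`). Then `f` is continuous on `U`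
(within `U`): along `xₙ → x₀` inside `U` the roots `f xₙ` stay bounded (Cauchy bound) and every
limit point lies in the relaxed Thom cell of `P x₀` for `σ`, which is `{f x₀}` by Thom's lemma.
This is `Literature.NumberTheory.Transcendental.continuousAt_of_thom_signs` with the open set
replaced by an arbitrary one and `𝓝 x₀` by `𝓝[U] x₀`; the proof is the same.
[cite: BasuPollackRoy2006, Lemma 5.33 (Thom's lemma) and Rem. 5.35] -/
theorem continuousWithinAt_of_thom_signs {m : ℕ} {U : Set (Fin m → ℝ)} {f : (Fin m → ℝ) → ℝ}
    (P : (Fin m → ℝ) → ℝ[X])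
    (hPc : ∀ j : ℕ, Continuous fun z : (Fin m → ℝ) × ℝ => (derivative^[j] (P z.1)).eval z.2)
    (hcoef : ∀ i : ℕ, Continuous fun x => (P x).coeff i)
    {e : ℕ} (he : ∀ x ∈ U, (P x).natDegree = e) (hP0 : ∀ x ∈ U, P x ≠ 0)
    {σ : ℕ → SignType} (hσ : σ 0 = 0)
    (hsign : ∀ x ∈ U, ∀ j ≤ e, SignType.sign ((derivative^[j] (P x)).eval (f x)) = σ j)
    {x₀ : Fin m → ℝ} (hx₀ : x₀ ∈ U) : ContinuousWithinAt f U x₀ := by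
  -- `f x` is a root of `P x` on `U`
  have hroot : ∀ x ∈ U, (P x).IsRoot (f x) := fun x hx => by
    have := hsign x hx 0 (Nat.zero_le _)
    rw [hσ, sign_eq_zero_iff] at this
    simpa using this
  -- a bound for the roots, continuous at `x₀`
  set B : (Fin m → ℝ) → ℝ := fun x =>
    (∑ i ∈ Finset.range e, |(P x).coeff i|) / |(P x).coeff e| + 1 with hB
  have hlc : (P x₀).coeff e ≠ 0 := by
    rw [← he x₀ hx₀]
    exact leadingCoeff_ne_zero.mpr (hP0 x₀ hx₀)
  have hBc : ContinuousAt B x₀ := by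
    refine ContinuousAt.add (ContinuousAt.div ?_ (hcoef e).abs.continuousAt (abs_ne_zero.mpr hlc))
      continuousAt_const
    exact (continuous_finsetSum _ fun i _ => (hcoef i).abs).continuousAt
  have hbd : ∀ x ∈ U, |f x| < B x := fun x hx =>
    Literature.NumberTheory.Transcendental.abs_lt_of_isRoot (he x hx) (hP0 x hx) (hroot x hx)
  have hev : ∀ᶠ x in 𝓝[U] x₀, x ∈ U ∧ |f x| < B x₀ + 1 := by
    have h1 : Tendsto B (𝓝[U] x₀) (𝓝 (B x₀)) := hBc.tendsto.mono_left nhdsWithin_le_nhds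
    filter_upwards [self_mem_nhdsWithin, h1.eventually_lt tendsto_const_nhds (lt_add_one (B x₀))]
      with x hx hx'
    exact ⟨hx, (hbd x hx).trans hx'⟩
  -- Thom's lemma at `x₀`: the relaxed cell is `{f x₀}`
  have hthom := (Thom.eq_singleton_of_mem (hP0 x₀ hx₀) hσ
    (y₀ := f x₀) (fun j hj => hsign x₀ hx₀ j ((he x₀ hx₀) ▸ hj))).2
  -- sequential argument
  change Tendsto f (𝓝[U] x₀) (𝓝 (f x₀))
  refine tendsto_of_subseq_tendsto fun ns hns => ?_
  obtain ⟨N₀, hN₀⟩ := eventually_atTop.mp (hns.eventually hev)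
  have hmem : ∀ n, f (ns (n + N₀)) ∈ Icc (-(B x₀ + 1)) (B x₀ + 1) := fun n => by
    have := (hN₀ (n + N₀) (Nat.le_add_left _ _)).2
    exact ⟨(abs_lt.mp this).1.le, (abs_lt.mp this).2.le⟩
  obtain ⟨a, -, φ, hφ, hlim⟩ := tendsto_subseq_of_bounded (Metric.isBounded_Icc _ _) hmem
  have hxlim : Tendsto (fun n => ns (φ n + N₀)) atTop (𝓝 x₀) :=
    (hns.mono_right nhdsWithin_le_nhds).comp ((tendsto_add_atTop_nat N₀).comp hφ.tendsto_atTop)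
  have hlim' : Tendsto (fun n => f (ns (φ n + N₀))) atTop (𝓝 a) := hlim
  -- the limit `a` lies in the relaxed Thom cell of `P x₀`, hence `a = f x₀`
  have ha : a = f x₀ := by
    have hrel : a ∈ {y | ∀ j ≤ (P x₀).natDegree,
        SignType.sign ((derivative^[j] (P x₀)).eval y) = σ j ∨
          (derivative^[j] (P x₀)).eval y = 0} := by
      intro j hj
      rw [he x₀ hx₀] at hj
      have hL : Tendsto (fun n => (derivative^[j] (P (ns (φ n + N₀)))).eval (f (ns (φ n + N₀))))
          atTop (𝓝 ((derivative^[j] (P x₀)).eval a)) :=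
        ((hPc j).tendsto (x₀, a)).comp (hxlim.prodMk_nhds hlim')
      have hsn : ∀ n, SignType.sign ((derivative^[j] (P (ns (φ n + N₀)))).eval
          (f (ns (φ n + N₀)))) = σ j :=
        fun n => hsign _ (hN₀ (φ n + N₀) (Nat.le_add_left _ _)).1 j hj
      rcases Thom.signType_cases (σ j) with h | h | h
      · right
        have hz : (fun n => (derivative^[j] (P (ns (φ n + N₀)))).eval (f (ns (φ n + N₀)))) =
            fun _ => 0 := by
          funext n
          have := hsn n
          rw [h, sign_eq_zero_iff] at this
          exact this
        rw [hz] at hL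
        exact (tendsto_nhds_unique tendsto_const_nhds hL).symm
      · have hle : (derivative^[j] (P x₀)).eval a ≤ 0 :=
          le_of_tendsto' hL fun n => by
            have := hsn n
            rw [h, sign_eq_neg_one_iff] at this
            exact this.le
        rcases hle.lt_or_eq with hlt | heq
        · left
          rw [h]
          exact sign_neg hlt
        · exact Or.inr heq
      · have hge : 0 ≤ (derivative^[j] (P x₀)).eval a :=
          ge_of_tendsto' hL fun n => by
            have := hsn n
            rw [h, sign_eq_one_iff] at this
            exact this.le
        rcases hge.lt_or_eq with hlt | heq
        · left
          rw [h]
          exact sign_pos hlt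
        · exact Or.inr heq.symm
    rw [hthom] at hrel
    exact hrel
  exact ⟨fun n => φ n + N₀, ha ▸ hlim'⟩

end ThomContinuity

/-! ### Specialisations of a family with polynomial coefficients -/

section Param

variable {k : Type*} [CommRing k] [Algebra k ℝ] {n : ℕ}

local notation3 "φ " x:arg => MvPolynomial.eval₂Hom (algebraMap k ℝ) x

local notation3 "rts[" P ", " x "]" =>
  SignDiagram.rts (Finset.image (fun f => Polynomial.map (MvPolynomial.eval₂Hom (algebraMap k ℝ) x) f) P)

/-- The set `rts[P, x]` of real roots of the non-zero specialisations `f(x, ·)`, `f ∈ P`, of a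
finite family `P ⊆ k[X₁, …, Xₙ][Y]` at `x ∈ ℝⁿ`: membership. [cite: BasuPollackRoy2006, Thm. 5.16] -/
theorem mem_rts_image {P : Finset (MvPolynomial (Fin n) k)[X]} {x : Fin n → ℝ} {z : ℝ} :
    z ∈ rts[P, x] ↔ ∃ f ∈ P, f.map (φ x) ≠ 0 ∧ (f.map (φ x)).eval z = 0 := by
  simp only [SignDiagram.mem_rts, Finset.mem_image]
  constructor
  · rintro ⟨g, ⟨f, hf, rfl⟩, hg0, hgz⟩
    exact ⟨f, hf, hg0, hgz⟩
  · rintro ⟨f, hf, hf0, hfz⟩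
    exact ⟨_, ⟨f, hf, rfl⟩, hf0, hfz⟩

/-- The root set of the first specialised family of `specPairs`. [cite: BasuPollackRoy2006, Thm. 5.16] -/
theorem rts_fam₁_specPairs (P : Finset (MvPolynomial (Fin n) k)[X]) (x x' : Fin n → ℝ) :
    SignDiagram.rts (SignDiagram.fam₁ (SignDiagram.specPairs P (φ x) (φ x'))) = rts[P, x] := by
  rw [SignDiagram.fam₁_specPairs]

/-- The root set of the second specialised family of `specPairs`. [cite: BasuPollackRoy2006, Thm. 5.16] -/
theorem rts_fam₂_specPairs (P : Finset (MvPolynomial (Fin n) k)[X]) (x x' : Fin n → ℝ) :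
    SignDiagram.rts (SignDiagram.fam₂ (SignDiagram.specPairs P (φ x) (φ x'))) = rts[P, x'] := by
  rw [SignDiagram.fam₂_specPairs]

/-- The family of specialisations at a point of a stable family is closed under derivative.
[cite: BasuPollackRoy2006, §5.4] -/
theorem derivative_mem_image_map {P : Finset (MvPolynomial (Fin n) k)[X]}
    (hP : SignDiagram.IsStable P) (x : Fin n → ℝ) :
    ∀ g ∈ P.image (fun f => f.map (φ x)), derivative g ∈ P.image (fun f => f.map (φ x)) := by
  intro g hg
  obtain ⟨f, hf, rfl⟩ := Finset.mem_image.mp hg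
  rw [Polynomial.derivative_map]
  exact Finset.mem_image_of_mem _ (hP.derivative_mem hf)

variable {P : Finset (MvPolynomial (Fin n) k)[X]} {x x' : Fin n → ℝ}

/-- Two points giving the same signs to all coefficients give specialisations vanishing
coefficientwise together. [cite: BasuPollackRoy2006, Thm. 5.16] -/
theorem coeff_map_eq_zero_iff
    (h : ∀ f ∈ P, ∀ i, SignType.sign ((φ x) (f.coeff i)) = SignType.sign ((φ x') (f.coeff i)))
    {f : (MvPolynomial (Fin n) k)[X]} (hf : f ∈ P) (i : ℕ) :
    (f.map (φ x)).coeff i = 0 ↔ (f.map (φ x')).coeff i = 0 := by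
  rw [coeff_map, coeff_map]
  have := h f hf i
  constructor <;> intro h0
  · rw [h0, sign_zero, eq_comm, sign_eq_zero_iff] at this; exact this
  · rw [h0, sign_zero, sign_eq_zero_iff] at this; exact this

/-- Two points giving the same signs to all coefficients give specialisations vanishing together.
[cite: BasuPollackRoy2006, Thm. 5.16] -/
theorem map_eq_zero_iff
    (h : ∀ f ∈ P, ∀ i, SignType.sign ((φ x) (f.coeff i)) = SignType.sign ((φ x') (f.coeff i)))
    {f : (MvPolynomial (Fin n) k)[X]} (hf : f ∈ P) : f.map (φ x) = 0 ↔ f.map (φ x') = 0 := by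
  simp only [Polynomial.ext_iff, coeff_zero]
  exact forall_congr' fun i => coeff_map_eq_zero_iff h hf i

/-- Two points giving the same signs to all coefficients give specialisations of the same degree.
[cite: BasuPollackRoy2006, Thm. 5.16] -/
theorem natDegree_map_eq
    (h : ∀ f ∈ P, ∀ i, SignType.sign ((φ x) (f.coeff i)) = SignType.sign ((φ x') (f.coeff i)))
    {f : (MvPolynomial (Fin n) k)[X]} (hf : f ∈ P) :
    (f.map (φ x)).natDegree = (f.map (φ x')).natDegree := by
  apply le_antisymm
  · rw [natDegree_le_iff_coeff_eq_zero]
    intro N hN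
    rw [coeff_map_eq_zero_iff h hf]
    exact coeff_eq_zero_of_natDegree_lt hN
  · rw [natDegree_le_iff_coeff_eq_zero]
    intro N hN
    rw [← coeff_map_eq_zero_iff h hf]
    exact coeff_eq_zero_of_natDegree_lt hN

/-- **Constancy of the number of roots** (from the parametric sign-diagram theorem): over two
points giving the same signs to all coefficients of a stable family, the specialised families have
the same number of real roots. [cite: BasuPollackRoy2006, Thm. 5.16] -/
theorem card_rts_eq (hP : SignDiagram.IsStable P)
    (h : ∀ f ∈ P, ∀ i, SignType.sign ((φ x) (f.coeff i)) = SignType.sign ((φ x') (f.coeff i))) :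
    (rts[P, x]).card = (rts[P, x']).card := by
  classical
  obtain ⟨e, he⟩ := SignDiagram.isoDiag_specPairs (φ x) (φ x') P hP h
  have hb := he.bijOn
  rw [rts_fam₁_specPairs, rts_fam₂_specPairs] at hb
  rw [← Set.ncard_coe_finset, ← Set.ncard_coe_finset, ← hb.image_eq, hb.injOn.ncard_image]

/-- **Sign invariance on graphs** (from the parametric sign-diagram theorem): over two points
giving the same signs to all coefficients of a stable family `P`, every member of `P` has the same
sign at the `i`-th roots (for any increasing enumerations `a`, `a'` of the two root sets).
[cite: BasuPollackRoy2006, Thm. 5.16] -/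
theorem sign_eval_apply_eq (hP : SignDiagram.IsStable P)
    (h : ∀ f ∈ P, ∀ i, SignType.sign ((φ x) (f.coeff i)) = SignType.sign ((φ x') (f.coeff i)))
    {m : ℕ} (hm : (rts[P, x]).card = m) {a a' : Fin m → ℝ} (ha : ∀ i, a i ∈ rts[P, x])
    (hmono : StrictMono a) (ha' : ∀ i, a' i ∈ rts[P, x']) (hmono' : StrictMono a')
    {f : (MvPolynomial (Fin n) k)[X]} (hf : f ∈ P) (i : Fin m) :
    SignType.sign ((f.map (φ x)).eval (a i)) = SignType.sign ((f.map (φ x')).eval (a' i)) := by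
  classical
  obtain ⟨e, he⟩ := SignDiagram.isoDiag_specPairs (φ x) (φ x') P hP h
  have hm' : (rts[P, x']).card = m := (card_rts_eq hP h).symm.trans hm
  have hb := he.bijOn
  have hsm := he.strictMonoOn
  rw [rts_fam₁_specPairs, rts_fam₂_specPairs] at hb
  rw [rts_fam₁_specPairs] at hsm
  have hei : e (a i) = a' i := apply_eq_of_strictMonoOn ha hmono hm' ha' hmono' hb.mapsTo hsm i
  have := he.sign_root _ (SignDiagram.mem_specPairs hf) (a i)
    (by rw [rts_fam₁_specPairs]; exact ha i)
  rw [hei] at this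
  exact this

/-- **Sign invariance on bands** (from the parametric sign-diagram theorem): over two points
giving the same signs to all coefficients of a stable family `P`, every member of `P` has the same
sign at any two points of the `j`-th bands (for sections `ξ` enumerating the roots increasingly over
both points). [cite: BasuPollackRoy2006, Thm. 5.16] -/
theorem sign_eval_eq_of_mem_band (hP : SignDiagram.IsStable P)
    (h : ∀ f ∈ P, ∀ i, SignType.sign ((φ x) (f.coeff i)) = SignType.sign ((φ x') (f.coeff i)))
    {m : ℕ} (hm : (rts[P, x]).card = m) {ξ : Fin m → (Fin n → ℝ) → ℝ}
    (hξ : (∀ i, ξ i x ∈ rts[P, x]) ∧ StrictMono fun i => ξ i x)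
    (hξ' : (∀ i, ξ i x' ∈ rts[P, x']) ∧ StrictMono fun i => ξ i x')
    {f : (MvPolynomial (Fin n) k)[X]} (hf : f ∈ P) (j : Fin (m + 1)) {t t' : ℝ}
    (ht : bandLower ξ j x < t ∧ (t : EReal) < bandUpper ξ j x)
    (ht' : bandLower ξ j x' < t' ∧ (t' : EReal) < bandUpper ξ j x') :
    SignType.sign ((f.map (φ x)).eval t) = SignType.sign ((f.map (φ x')).eval t') := by
  classical
  obtain ⟨e, he⟩ := SignDiagram.isoDiag_specPairs (φ x) (φ x') P hP h
  have hm' : (rts[P, x']).card = m := (card_rts_eq hP h).symm.trans hm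
  have hb := he.bijOn
  have hsm := he.strictMonoOn
  rw [rts_fam₁_specPairs, rts_fam₂_specPairs] at hb
  rw [rts_fam₁_specPairs] at hsm
  rw [mem_band_iff ξ x hξ.2] at ht
  rw [mem_band_iff ξ x' hξ'.2] at ht'
  refine he.sign_gap _ (SignDiagram.mem_specPairs hf) t t' ?_ ?_ ?_
  · rw [rts_fam₁_specPairs]
    intro htm
    obtain ⟨i, hi⟩ := exists_eq_apply_of_mem hm hξ.1 hξ.2 htm
    exact ht.1 i hi.symm
  · rw [rts_fam₂_specPairs]
    intro htm
    obtain ⟨i, hi⟩ := exists_eq_apply_of_mem hm' hξ'.1 hξ'.2 htm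
    exact ht'.1 i hi.symm
  · intro z hz
    rw [rts_fam₁_specPairs] at hz
    obtain ⟨i, rfl⟩ := exists_eq_apply_of_mem hm hξ.1 hξ.2 hz
    rw [apply_eq_of_strictMonoOn hξ.1 hξ.2 hm' hξ'.1 hξ'.2 hb.mapsTo hsm i]
    exact (ht.2 i).trans (ht'.2 i).symm

/-! ### Continuity of the sections within a coefficient-sign-invariant set -/

/-- **Continuity of the ordered roots** over a set `S` on which all coefficients of a stable
family `P` have constant signs: sections `ξⱼ` enumerating increasingly, over each point of `S`,
the real roots of the specialised family are continuous on `S`. By Rem. 5.35, `ξⱼ(x)` is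
throughout `S` a root of a fixed member of `P` selected by a fixed Thom sign condition on its
derivatives (which lie in `P`), of constant degree; conclude by
`continuousWithinAt_of_thom_signs`. (BPR derive continuity from continuity of the roots in the
coefficients, Thm. 5.12 / Prop. 5.13; Thom's lemma is their §5.4.)
[cite: BasuPollackRoy2006, Thm. 5.16 and Rem. 5.35] -/
theorem continuousWithinAt_section (hP : SignDiagram.IsStable P) {S : Set (Fin n → ℝ)}
    (hS : ∀ x ∈ S, ∀ x' ∈ S, ∀ f ∈ P, ∀ i,
      SignType.sign ((φ x) (f.coeff i)) = SignType.sign ((φ x') (f.coeff i)))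
    {m : ℕ} (hm : ∀ x ∈ S, (rts[P, x]).card = m) {ξ : Fin m → (Fin n → ℝ) → ℝ}
    (hξ : ∀ x ∈ S, (∀ i, ξ i x ∈ rts[P, x]) ∧ StrictMono fun i => ξ i x)
    {x₀ : Fin n → ℝ} (hx₀ : x₀ ∈ S) (j : Fin m) : ContinuousWithinAt (ξ j) S x₀ := by
  obtain ⟨g, hg, hg0, hgr⟩ := mem_rts_image.mp ((hξ x₀ hx₀).1 j)
  set q : MvPolynomial (Fin (n + 1)) k := (MvPolynomial.finSuccEquiv k n).symm g with hq
  have hgq : MvPolynomial.finSuccEquiv k n q = g := by rw [hq, AlgEquiv.apply_symm_apply]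
  set σ : ℕ → SignType :=
    fun i => SignType.sign ((derivative^[i] (g.map (φ x₀))).eval (ξ j x₀)) with hσ
  refine continuousWithinAt_of_thom_signs (fun y => g.map (φ y)) ?_ ?_
    (e := (g.map (φ x₀)).natDegree) ?_ ?_ (σ := σ) ?_ ?_ hx₀
  · intro i
    have := Literature.NumberTheory.Transcendental.continuous_eval_iterate_derivative_map q i
    rw [hgq] at this
    exact this
  · intro i
    have := Literature.NumberTheory.Transcendental.continuous_coeff_map_finSuccEquiv q i
    rw [hgq] at this
    exact this
  · intro y hy
    exact natDegree_map_eq (hS y hy x₀ hx₀) hg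
  · intro y hy
    rw [Ne, map_eq_zero_iff (hS y hy x₀ hx₀) hg]
    exact hg0
  · simp only [hσ, Function.iterate_zero, id_eq, hgr, sign_zero]
  · intro y hy i _
    simp only [hσ, Polynomial.iterate_derivative_map]
    exact sign_eval_apply_eq hP (hS y hy x₀ hx₀) (hm y hy) (hξ y hy).1 (hξ y hy).2
      (hξ x₀ hx₀).1 (hξ x₀ hx₀).2 (hP.iterate_derivative_mem hg i) j

/-- The sections are continuous on a set on which all coefficients of the stable family have
constant signs. [cite: BasuPollackRoy2006, Thm. 5.16] -/
theorem continuousOn_section (hP : SignDiagram.IsStable P) {S : Set (Fin n → ℝ)}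
    (hS : ∀ x ∈ S, ∀ x' ∈ S, ∀ f ∈ P, ∀ i,
      SignType.sign ((φ x) (f.coeff i)) = SignType.sign ((φ x') (f.coeff i)))
    {m : ℕ} (hm : ∀ x ∈ S, (rts[P, x]).card = m) {ξ : Fin m → (Fin n → ℝ) → ℝ}
    (hξ : ∀ x ∈ S, (∀ i, ξ i x ∈ rts[P, x]) ∧ StrictMono fun i => ξ i x) (j : Fin m) :
    ContinuousOn (ξ j) S :=
  fun _ hy => continuousWithinAt_section hP hS hm hξ hy j

/-! ### Semialgebraic description of the graphs and bands (Thm. 5.34) -/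

omit [Algebra k ℝ] in
/-- `(z_last, z₀, …, z_{n-1})` is `z` read through the inverse cyclic rotation. [folklore] -/
theorem cons_last_init (z : Fin (n + 1) → ℝ) :
    (Fin.cons (z (Fin.last n)) (Fin.init z) : Fin (n + 1) → ℝ) = z ∘ (finRotate (n + 1)).symm := by
  have h := Fin.snoc_eq_cons_rotate (Fin.init z) (z (Fin.last n))
  rw [Fin.snoc_init_self] at h
  funext i
  rw [Function.comp_apply]
  conv_rhs => rw [h]
  simp only [Equiv.apply_symm_apply]

/-- Evaluating the specialisation at `init z` of `f ∈ k[X₁, …, Xₙ][Y]` at `z_last` is evaluating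
the corresponding polynomial in `n + 1` variables at a permutation of `z`. [folklore] -/
theorem eval_map_init_last (f : (MvPolynomial (Fin n) k)[X]) (z : Fin (n + 1) → ℝ) :
    (f.map (φ (Fin.init z))).eval (z (Fin.last n)) =
      MvPolynomial.aeval (z ∘ (finRotate (n + 1)).symm) ((MvPolynomial.finSuccEquiv k n).symm f) := by
  rw [← cons_last_init, ← eval_map_finSuccEquiv, AlgEquiv.apply_symm_apply]

/-- Sign sets `{z | sign f(init z, ·)(z_last) = s}` of specialisations are `k`-semialgebraic.
[cite: BasuPollackRoy2006, Thm. 5.34] -/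
theorem isSemialgebraic_setOf_sign_eval_map (f : (MvPolynomial (Fin n) k)[X]) (s : SignType) :
    IsSemialgebraic k {z : Fin (n + 1) → ℝ |
      SignType.sign ((f.map (φ (Fin.init z))).eval (z (Fin.last n))) = s} := by
  have := (isSemialgebraic_setOf_sign_aeval_eq ((MvPolynomial.finSuccEquiv k n).symm f) s).preimage_comp
    (ι := Fin (n + 1)) ((finRotate (n + 1)).symm)
  convert this using 1
  ext z
  simp only [mem_setOf_eq, mem_preimage, eval_map_init_last]

/-- **Graphs are sign cells.** Over a set `S` on which all coefficients of the stable family `P`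
have constant signs, the graph of the `j`-th section is the set of points above `S` at which the
members of `P` have the signs they have at the `j`-th root over a base point `x₀ ∈ S` (Thom's
lemma separates the roots by their sign vectors). [cite: BasuPollackRoy2006, Thm. 5.34] -/
theorem graphOver_eq_setOf_sign (hP : SignDiagram.IsStable P) {S : Set (Fin n → ℝ)}
    (hS : ∀ x ∈ S, ∀ x' ∈ S, ∀ f ∈ P, ∀ i,
      SignType.sign ((φ x) (f.coeff i)) = SignType.sign ((φ x') (f.coeff i)))
    {m : ℕ} (hm : ∀ x ∈ S, (rts[P, x]).card = m) {ξ : Fin m → (Fin n → ℝ) → ℝ}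
    (hξ : ∀ x ∈ S, (∀ i, ξ i x ∈ rts[P, x]) ∧ StrictMono fun i => ξ i x)
    {x₀ : Fin n → ℝ} (hx₀ : x₀ ∈ S) (j : Fin m) :
    graphOver S (ξ j) = {z : Fin (n + 1) → ℝ | Fin.init z ∈ S ∧ ∀ f ∈ P,
      SignType.sign ((f.map (φ (Fin.init z))).eval (z (Fin.last n))) =
        SignType.sign ((f.map (φ x₀)).eval (ξ j x₀))} := by
  classical
  ext z
  simp only [mem_graphOver_iff, mem_setOf_eq]
  constructor
  · rintro ⟨hzS, hzt⟩
    refine ⟨hzS, fun f hf => ?_⟩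
    rw [hzt]
    exact sign_eval_apply_eq hP (hS _ hzS _ hx₀) (hm _ hzS) (hξ _ hzS).1 (hξ _ hzS).2
      (hξ _ hx₀).1 (hξ _ hx₀).2 hf j
  · rintro ⟨hzS, hsig⟩
    refine ⟨hzS, ?_⟩
    set x := Fin.init z with hx
    obtain ⟨g, hg, hg0, hgu⟩ := mem_rts_image.mp ((hξ x hzS).1 j)
    have hF := derivative_mem_image_map hP x
    symm
    refine eq_of_eval_eq_zero_of_forall_sign_eq hF (Finset.mem_image_of_mem _ hg) hg0 hgu ?_
    intro p hp
    obtain ⟨f, hf, rfl⟩ := Finset.mem_image.mp hp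
    rw [hsig f hf]
    exact sign_eval_apply_eq hP (hS _ hzS _ hx₀) (hm _ hzS) (hξ _ hzS).1 (hξ _ hzS).2
      (hξ _ hx₀).1 (hξ _ hx₀).2 hf j

/-- **Bands are sign cells.** Over a set `S` on which all coefficients of the stable family `P`
have constant signs, the `j`-th band is the set of points above `S` at which the members of `P`
have the signs they have at a point `t₀` of the `j`-th band over a base point `x₀ ∈ S` (Thom's
lemma separates the gaps by their sign vectors). [cite: BasuPollackRoy2006, Thm. 5.34] -/
theorem bandOver_eq_setOf_sign (hP : SignDiagram.IsStable P) {S : Set (Fin n → ℝ)}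
    (hS : ∀ x ∈ S, ∀ x' ∈ S, ∀ f ∈ P, ∀ i,
      SignType.sign ((φ x) (f.coeff i)) = SignType.sign ((φ x') (f.coeff i)))
    {m : ℕ} (hm : ∀ x ∈ S, (rts[P, x]).card = m) {ξ : Fin m → (Fin n → ℝ) → ℝ}
    (hξ : ∀ x ∈ S, (∀ i, ξ i x ∈ rts[P, x]) ∧ StrictMono fun i => ξ i x)
    {x₀ : Fin n → ℝ} (hx₀ : x₀ ∈ S) (j : Fin (m + 1))
    {t₀ : ℝ} (ht₀ : bandLower ξ j x₀ < t₀ ∧ (t₀ : EReal) < bandUpper ξ j x₀) :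
    bandOver S ξ j = {z : Fin (n + 1) → ℝ | Fin.init z ∈ S ∧ ∀ f ∈ P,
      SignType.sign ((f.map (φ (Fin.init z))).eval (z (Fin.last n))) =
        SignType.sign ((f.map (φ x₀)).eval t₀)} := by
  classical
  ext z
  simp only [mem_bandOver_iff, mem_setOf_eq]
  constructor
  · rintro ⟨hzS, hzt⟩
    refine ⟨hzS, fun f hf => ?_⟩
    exact sign_eval_eq_of_mem_band hP (hS _ hzS _ hx₀) (hm _ hzS) (hξ _ hzS) (hξ _ hx₀) hf j
      hzt ht₀
  · rintro ⟨hzS, hsig⟩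
    refine ⟨hzS, ?_⟩
    set x := Fin.init z with hx
    set t := z (Fin.last n) with ht
    have hmono : StrictMono fun i : Fin m => ξ i x := (hξ x hzS).2
    obtain ⟨u, hu⟩ := exists_mem_band ξ x hmono j
    have hF := derivative_mem_image_map hP x
    -- `t` and `u` give the same signs to the specialised family
    have htu : ∀ p ∈ P.image (fun f => f.map (φ x)),
        SignType.sign (p.eval t) = SignType.sign (p.eval u) := by
      intro p hp
      obtain ⟨f, hf, rfl⟩ := Finset.mem_image.mp hp
      rw [hsig f hf]
      exact (sign_eval_eq_of_mem_band hP (hS _ hzS _ hx₀) (hm _ hzS) (hξ _ hzS) (hξ _ hx₀) hf j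
        hu ht₀).symm
    have hu' := (mem_band_iff ξ x hmono j u).mp hu
    have huR : u ∉ rts[P, x] := fun huR => by
      obtain ⟨i, hi⟩ := exists_eq_apply_of_mem (hm x hzS) (hξ x hzS).1 hmono huR
      exact hu'.1 i hi.symm
    -- `t` is not a root of the family
    have htR : t ∉ rts[P, x] := by
      intro htR
      obtain ⟨g, hg, hg0, hgt⟩ := mem_rts_image.mp htR
      have := eq_of_eval_eq_zero_of_forall_sign_eq hF (Finset.mem_image_of_mem _ hg) hg0 hgt htu
      rw [← this] at huR
      exact huR htR
    rw [mem_band_iff ξ x hmono j t]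
    refine ⟨fun i hi => htR (hi ▸ (hξ x hzS).1 i), fun i => ?_⟩
    rw [← hu'.2 i]
    exact lt_iff_lt_of_forall_sign_eq hF htu htR ((hξ x hzS).1 i)

/-- A set of points above `S` cut out by prescribing the signs of the specialisations of the
members of `P` is `k`-semialgebraic when `S` is. [cite: BasuPollackRoy2006, Thm. 5.34] -/
theorem isSemialgebraic_setOf_init_mem_and_forall_sign_eq {S : Set (Fin n → ℝ)}
    (hSsa : IsSemialgebraic k S) (P : Finset (MvPolynomial (Fin n) k)[X])
    (c : (MvPolynomial (Fin n) k)[X] → SignType) :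
    IsSemialgebraic k {z : Fin (n + 1) → ℝ | Fin.init z ∈ S ∧ ∀ f ∈ P,
      SignType.sign ((f.map (φ (Fin.init z))).eval (z (Fin.last n))) = c f} := by
  have hset : {z : Fin (n + 1) → ℝ | Fin.init z ∈ S ∧ ∀ f ∈ P,
      SignType.sign ((f.map (φ (Fin.init z))).eval (z (Fin.last n))) = c f} =
      {z : Fin (n + 1) → ℝ | Fin.init z ∈ S} ∩ ⋂ f ∈ P, {z |
        SignType.sign ((f.map (φ (Fin.init z))).eval (z (Fin.last n))) = c f} := by
    ext z
    simp only [mem_setOf_eq, mem_inter_iff, mem_iInter]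
  rw [hset]
  exact hSsa.setOf_init_mem.inter
    (IsSemialgebraic.biInter P _ fun f _ => isSemialgebraic_setOf_sign_eval_map f (c f))

/-- **Graphs are semialgebraic.** [cite: BasuPollackRoy2006, Thm. 5.16 / Thm. 5.34] -/
theorem isSemialgebraic_graphOver (hP : SignDiagram.IsStable P)
    {S : Set (Fin n → ℝ)} (hSsa : IsSemialgebraic k S)
    (hS : ∀ x ∈ S, ∀ x' ∈ S, ∀ f ∈ P, ∀ i,
      SignType.sign ((φ x) (f.coeff i)) = SignType.sign ((φ x') (f.coeff i)))
    {m : ℕ} (hm : ∀ x ∈ S, (rts[P, x]).card = m) {ξ : Fin m → (Fin n → ℝ) → ℝ}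
    (hξ : ∀ x ∈ S, (∀ i, ξ i x ∈ rts[P, x]) ∧ StrictMono fun i => ξ i x)
    {x₀ : Fin n → ℝ} (hx₀ : x₀ ∈ S) (j : Fin m) :
    IsSemialgebraic k (graphOver S (ξ j)) := by
  rw [graphOver_eq_setOf_sign hP hS hm hξ hx₀ j]
  exact isSemialgebraic_setOf_init_mem_and_forall_sign_eq hSsa P _

/-- **Bands are semialgebraic.** [cite: BasuPollackRoy2006, Thm. 5.16 / Thm. 5.34] -/
theorem isSemialgebraic_bandOver (hP : SignDiagram.IsStable P)
    {S : Set (Fin n → ℝ)} (hSsa : IsSemialgebraic k S)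
    (hS : ∀ x ∈ S, ∀ x' ∈ S, ∀ f ∈ P, ∀ i,
      SignType.sign ((φ x) (f.coeff i)) = SignType.sign ((φ x') (f.coeff i)))
    {m : ℕ} (hm : ∀ x ∈ S, (rts[P, x]).card = m) {ξ : Fin m → (Fin n → ℝ) → ℝ}
    (hξ : ∀ x ∈ S, (∀ i, ξ i x ∈ rts[P, x]) ∧ StrictMono fun i => ξ i x)
    {x₀ : Fin n → ℝ} (hx₀ : x₀ ∈ S) (j : Fin (m + 1)) :
    IsSemialgebraic k (bandOver S ξ j) := by
  obtain ⟨t₀, ht₀⟩ := exists_mem_band ξ x₀ (hξ x₀ hx₀).2 j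
  rw [bandOver_eq_setOf_sign hP hS hm hξ hx₀ j ht₀]
  exact isSemialgebraic_setOf_init_mem_and_forall_sign_eq hSsa P _

/-- The sections are `k`-semialgebraic functions on `S`. [cite: BasuPollackRoy2006, Thm. 5.16] -/
theorem isSemialgebraicFunOn_section (hP : SignDiagram.IsStable P)
    {S : Set (Fin n → ℝ)} (hSsa : IsSemialgebraic k S)
    (hS : ∀ x ∈ S, ∀ x' ∈ S, ∀ f ∈ P, ∀ i,
      SignType.sign ((φ x) (f.coeff i)) = SignType.sign ((φ x') (f.coeff i)))
    {m : ℕ} (hm : ∀ x ∈ S, (rts[P, x]).card = m) {ξ : Fin m → (Fin n → ℝ) → ℝ}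
    (hξ : ∀ x ∈ S, (∀ i, ξ i x ∈ rts[P, x]) ∧ StrictMono fun i => ξ i x)
    {x₀ : Fin n → ℝ} (hx₀ : x₀ ∈ S) (j : Fin m) :
    IsSemialgebraicFunOn k S (ξ j) := by
  rw [isSemialgebraicFunOn_iff_isSemialgebraic_graphOver]
  exact isSemialgebraic_graphOver hP hSsa hS hm hξ hx₀ j

/-- **Sign invariance on the cells over `S`**: every member of `P` has constant sign on each graph
and each band over a coefficient-sign-invariant set `S`. [cite: BasuPollackRoy2006, Thm. 5.16] -/
theorem sign_eval_eq_of_mem_cell (hP : SignDiagram.IsStable P) {S : Set (Fin n → ℝ)}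
    (hS : ∀ x ∈ S, ∀ x' ∈ S, ∀ f ∈ P, ∀ i,
      SignType.sign ((φ x) (f.coeff i)) = SignType.sign ((φ x') (f.coeff i)))
    {m : ℕ} (hm : ∀ x ∈ S, (rts[P, x]).card = m) {ξ : Fin m → (Fin n → ℝ) → ℝ}
    (hξ : ∀ x ∈ S, (∀ i, ξ i x ∈ rts[P, x]) ∧ StrictMono fun i => ξ i x)
    {T : Set (Fin (n + 1) → ℝ)} (hT : (∃ j, T = graphOver S (ξ j)) ∨ ∃ j, T = bandOver S ξ j)
    {f : (MvPolynomial (Fin n) k)[X]} (hf : f ∈ P) {z z' : Fin (n + 1) → ℝ} (hz : z ∈ T)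
    (hz' : z' ∈ T) :
    SignType.sign ((f.map (φ (Fin.init z))).eval (z (Fin.last n))) =
      SignType.sign ((f.map (φ (Fin.init z'))).eval (z' (Fin.last n))) := by
  rcases hT with ⟨j, rfl⟩ | ⟨j, rfl⟩
  · have hx₀ : Fin.init z ∈ S := (mem_graphOver_iff.mp hz).1
    rw [graphOver_eq_setOf_sign hP hS hm hξ hx₀ j] at hz hz'
    rw [hz.2 f hf, hz'.2 f hf]
  · have hx₀ : Fin.init z ∈ S := (mem_bandOver_iff.mp hz).1
    rw [bandOver_eq_setOf_sign hP hS hm hξ hx₀ j (mem_bandOver_iff.mp hz).2] at hz'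
    exact (hz'.2 f hf).symm

end Param

/-! ### The stack of graphs and bands over a partition -/

section Stack

variable {n : ℕ} {𝒮 : Finset (Set (Fin n → ℝ))} {l : Set (Fin n → ℝ) → ℕ}
  {ξ : (S : Set (Fin n → ℝ)) → Fin (l S) → (Fin n → ℝ) → ℝ}
  {𝒯 : Finset (Set (Fin (n + 1) → ℝ))}

/-- **The stack over a partition is a partition** of `ℝⁿ⁺¹` (for strictly increasing sections): if
`𝒯` consists exactly of the graphs `graphOver S (ξ S j)` and bands `bandOver S (ξ S) j` over the
members `S` of a finite partition `𝒮` of `ℝⁿ`, then every point `(x', t)` lies above exactly one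
cell `S ∋ x'`, and `t` is either exactly one section value `ξ_{S,j}(x')` or lies in exactly one
band; no cell is empty. [cite: BasuPollackRoy2006, Def. 5.1 and Rem. 5.2] -/
theorem isPartition_of_mem_iff
    (h𝒯 : ∀ T, T ∈ 𝒯 ↔ ∃ S ∈ 𝒮, (∃ j, T = graphOver S (ξ S j)) ∨ ∃ j, T = bandOver S (ξ S) j)
    (h𝒮 : Setoid.IsPartition (𝒮 : Set (Set (Fin n → ℝ))))
    (hmono : ∀ S ∈ 𝒮, ∀ x ∈ S, StrictMono fun j => ξ S j x) :
    Setoid.IsPartition (𝒯 : Set (Set (Fin (n + 1) → ℝ))) := by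
  have hne : ∀ S ∈ 𝒮, S.Nonempty := fun S hS =>
    Set.nonempty_iff_ne_empty.mpr fun h => h𝒮.1 (by rw [Finset.mem_coe, ← h]; exact hS)
  refine ⟨fun h0 => ?_, fun z => ?_⟩
  · rw [Finset.mem_coe, h𝒯] at h0
    obtain ⟨S, hS, hT⟩ := h0
    obtain ⟨x, hx⟩ := hne S hS
    rcases hT with ⟨j, hj⟩ | ⟨j, hj⟩
    · have : (Fin.snoc x (ξ S j x) : Fin (n + 1) → ℝ) ∈ (∅ : Set (Fin (n + 1) → ℝ)) := by
        rw [hj, snoc_mem_graphOver_iff]; exact ⟨hx, rfl⟩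
      exact this
    · obtain ⟨t, ht⟩ := exists_mem_band (ξ S) x (hmono S hS x hx) j
      have : (Fin.snoc x t : Fin (n + 1) → ℝ) ∈ (∅ : Set (Fin (n + 1) → ℝ)) := by
        rw [hj, snoc_mem_bandOver_iff]; exact ⟨hx, ht⟩
      exact this
  · obtain ⟨S, ⟨hS, hxS⟩, huniq⟩ := h𝒮.2 (Fin.init z)
    rw [Finset.mem_coe] at hS
    have hSuniq : ∀ S' ∈ 𝒮, Fin.init z ∈ S' → S' = S :=
      fun S' hS' hx' => huniq S' ⟨Finset.mem_coe.mpr hS', hx'⟩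
    have hm := hmono S hS _ hxS
    rcases exists_eq_or_exists_mem_band (ξ S) (Fin.init z) hm (z (Fin.last n)) with
      ⟨i, hi⟩ | ⟨j, hj⟩
    · refine ⟨graphOver S (ξ S i), ⟨?_, ⟨hxS, hi⟩⟩, ?_⟩
      · rw [Finset.mem_coe, h𝒯]; exact ⟨S, hS, Or.inl ⟨i, rfl⟩⟩
      · rintro T ⟨hT, hzT⟩
        rw [Finset.mem_coe, h𝒯] at hT
        obtain ⟨S', hS', hT⟩ := hT
        rcases hT with ⟨j', rfl⟩ | ⟨j', rfl⟩
        · obtain ⟨hx', hz'⟩ := mem_graphOver_iff.mp hzT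
          obtain rfl := hSuniq S' hS' hx'
          have : j' = i := hm.injective (hz'.symm.trans hi)
          rw [this]
        · obtain ⟨hx', hz'⟩ := mem_bandOver_iff.mp hzT
          obtain rfl := hSuniq S' hS' hx'
          exact absurd hz' (not_mem_band_of_eq (ξ S') (Fin.init z) hm hi)
    · refine ⟨bandOver S (ξ S) j, ⟨?_, ⟨hxS, hj⟩⟩, ?_⟩
      · rw [Finset.mem_coe, h𝒯]; exact ⟨S, hS, Or.inr ⟨j, rfl⟩⟩
      · rintro T ⟨hT, hzT⟩
        rw [Finset.mem_coe, h𝒯] at hT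
        obtain ⟨S', hS', hT⟩ := hT
        rcases hT with ⟨j', rfl⟩ | ⟨j', rfl⟩
        · obtain ⟨hx', hz'⟩ := mem_graphOver_iff.mp hzT
          obtain rfl := hSuniq S' hS' hx'
          exact absurd hj (not_mem_band_of_eq (ξ S') (Fin.init z) hm hz')
        · obtain ⟨hx', hz'⟩ := mem_bandOver_iff.mp hzT
          obtain rfl := hSuniq S' hS' hx'
          rw [band_eq_band (ξ S') (Fin.init z) hm hj hz']

end Stack

/-! ### The inductive step (Thm. 5.16 ⇒ Thm. 5.6) and the existence theorems -/

section Existence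

variable {k : Type*} [CommRing k] [Algebra k ℝ] {n : ℕ}

local notation3 "φ " x:arg => MvPolynomial.eval₂Hom (algebraMap k ℝ) x

local notation3 "rts[" P ", " x "]" =>
  SignDiagram.rts (Finset.image (fun f => Polynomial.map (MvPolynomial.eval₂Hom (algebraMap k ℝ) x) f) P)

/-- **Inductive step of Thm. 5.6** (the content of Thm. 5.16 with Thm. 5.34). Let `𝒮` be a
cylindrical decomposition of `ℝⁿ` with `k`-semialgebraic cells, and `P ⊆ k[X₁, …, Xₙ][Y]` a
finite stable family all of whose coefficients have constant sign on each cell of `𝒮` (the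
analogue of `Elim_{X_{n+1}}(P)`-invariance). Then the graphs and bands of the ordered real roots of
the specialisations of `P` over the cells of `𝒮` form a cylindrical decomposition of `ℝⁿ⁺¹` with
`k`-semialgebraic cells, on each cell of which every member of `P` has constant sign.
[cite: BasuPollackRoy2006, Thm. 5.16 and proof of Thm. 5.6 (p. 214)] -/
theorem exists_isCylindricalDecomposition_succ {𝒮 : Finset (Set (Fin n → ℝ))}
    (h𝒮 : IsCylindricalDecomposition k n 𝒮) {P : Finset (MvPolynomial (Fin n) k)[X]}
    (hP : SignDiagram.IsStable P)
    (hinv : ∀ S ∈ 𝒮, ∀ x ∈ S, ∀ x' ∈ S, ∀ f ∈ P, ∀ i,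
      SignType.sign ((φ x) (f.coeff i)) = SignType.sign ((φ x') (f.coeff i))) :
    ∃ 𝒯 : Finset (Set (Fin (n + 1) → ℝ)), IsCylindricalDecomposition k (n + 1) 𝒯 ∧
      ∀ T ∈ 𝒯, ∀ f ∈ P, ∀ z ∈ T, ∀ z' ∈ T,
        SignType.sign ((f.map (φ (Fin.init z))).eval (z (Fin.last n))) =
          SignType.sign ((f.map (φ (Fin.init z'))).eval (z' (Fin.last n))) := by
  classical
  have hpart := h𝒮.isPartition
  have hne : ∀ S ∈ 𝒮, S.Nonempty := fun S hS =>
    Set.nonempty_iff_ne_empty.mpr fun h => hpart.1 (by rw [Finset.mem_coe, ← h]; exact hS)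
  -- the number of sections over `S`: the number of roots over any point of `S`
  let l : Set (Fin n → ℝ) → ℕ := fun S => if h : S.Nonempty then (rts[P, h.some]).card else 0
  -- the sections over `S`: the increasing enumeration of the roots, where there are `l S` of them
  let ξ : (S : Set (Fin n → ℝ)) → Fin (l S) → (Fin n → ℝ) → ℝ := fun S i x =>
    if h : (rts[P, x]).card = l S then (rts[P, x]).orderEmbOfFin h i else 0
  have hl : ∀ S ∈ 𝒮, ∀ x ∈ S, (rts[P, x]).card = l S := fun S hS x hx => by
    have h0 : (rts[P, (hne S hS).some]).card = l S := by simp only [l, dif_pos (hne S hS)]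
    exact (card_rts_eq hP (hinv S hS x hx _ (hne S hS).some_mem)).trans h0
  have hξ : ∀ S ∈ 𝒮, ∀ x ∈ S, (∀ i, ξ S i x ∈ rts[P, x]) ∧ StrictMono fun i => ξ S i x := by
    intro S hS x hx
    have hfun : (fun i => ξ S i x) = (rts[P, x]).orderEmbOfFin (hl S hS x hx) := by
      funext i
      simp only [ξ, dif_pos (hl S hS x hx)]
    refine ⟨fun i => ?_, ?_⟩
    · rw [show ξ S i x = (fun i => ξ S i x) i from rfl, hfun]
      exact Finset.orderEmbOfFin_mem _ _ i
    · rw [hfun]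
      exact OrderEmbedding.strictMono _
  have hmono : ∀ S ∈ 𝒮, ∀ x ∈ S, StrictMono fun j => ξ S j x := fun S hS x hx => (hξ S hS x hx).2
  -- the stack of graphs and bands
  set 𝒯 : Finset (Set (Fin (n + 1) → ℝ)) := 𝒮.biUnion fun S =>
    (Finset.univ.image fun j : Fin (l S) => graphOver S (ξ S j)) ∪
      (Finset.univ.image fun j : Fin (l S + 1) => bandOver S (ξ S) j) with h𝒯def
  have h𝒯 : ∀ T, T ∈ 𝒯 ↔
      ∃ S ∈ 𝒮, (∃ j, T = graphOver S (ξ S j)) ∨ ∃ j, T = bandOver S (ξ S) j := by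
    intro T
    simp only [h𝒯def, Finset.mem_biUnion, Finset.mem_union, Finset.mem_image, Finset.mem_univ,
      true_and]
    constructor
    · rintro ⟨S, hS, ⟨j, hj⟩ | ⟨j, hj⟩⟩
      · exact ⟨S, hS, Or.inl ⟨j, hj.symm⟩⟩
      · exact ⟨S, hS, Or.inr ⟨j, hj.symm⟩⟩
    · rintro ⟨S, hS, ⟨j, hj⟩ | ⟨j, hj⟩⟩
      · exact ⟨S, hS, Or.inl ⟨j, hj.symm⟩⟩
      · exact ⟨S, hS, Or.inr ⟨j, hj.symm⟩⟩
  refine ⟨𝒯, ⟨isPartition_of_mem_iff h𝒯 hpart hmono, ?_, 𝒮, h𝒮, l, ξ, ?_, ?_, hmono, h𝒯⟩, ?_⟩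
  · -- the cells are semialgebraic
    intro T hT
    obtain ⟨S, hS, hT⟩ := (h𝒯 T).mp hT
    obtain ⟨x₀, hx₀⟩ := hne S hS
    rcases hT with ⟨j, rfl⟩ | ⟨j, rfl⟩
    · exact isSemialgebraic_graphOver hP (h𝒮.isSemialgebraic S hS) (hinv S hS) (hl S hS)
        (hξ S hS) hx₀ j
    · exact isSemialgebraic_bandOver hP (h𝒮.isSemialgebraic S hS) (hinv S hS) (hl S hS)
        (hξ S hS) hx₀ j
  · -- the sections are continuous on the cells
    intro S hS j
    exact continuousOn_section hP (hinv S hS) (hl S hS) (hξ S hS) j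
  · -- the sections are semialgebraic on the cells
    intro S hS j
    obtain ⟨x₀, hx₀⟩ := hne S hS
    exact isSemialgebraicFunOn_section hP (h𝒮.isSemialgebraic S hS) (hinv S hS) (hl S hS)
      (hξ S hS) hx₀ j
  · -- the members of `P` have constant sign on the cells
    intro T hT f hf z hz z' hz'
    obtain ⟨S, hS, hT⟩ := (h𝒯 T).mp hT
    exact sign_eval_eq_of_mem_cell hP (hinv S hS) (hl S hS) (hξ S hS) hT hf hz hz'

/-- Evaluation lemma for the passage to `k[X₁, …, Xₙ][Y]` singling out the LAST variable,
`q ↦ finSuccEquiv (rename (finRotate (n + 1)) q)`: the specialisation at `init z` evaluated at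
`z_last` is `q(z)`. [folklore] -/
theorem eval_map_finSuccEquiv_rename_finRotate (q : MvPolynomial (Fin (n + 1)) k)
    (z : Fin (n + 1) → ℝ) :
    ((MvPolynomial.finSuccEquiv k n (MvPolynomial.rename (finRotate (n + 1)) q)).map
        (φ (Fin.init z))).eval (z (Fin.last n)) = MvPolynomial.aeval z q := by
  rw [eval_map_finSuccEquiv, MvPolynomial.aeval_rename]
  have h := Fin.snoc_eq_cons_rotate (Fin.init z) (z (Fin.last n))
  rw [Fin.snoc_init_self] at h
  have h' : (Fin.cons (z (Fin.last n)) (Fin.init z) : Fin (n + 1) → ℝ) ∘ ⇑(finRotate (n + 1)) =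
      z := by
    funext i
    rw [Function.comp_apply]
    exact (congrFun h i).symm
  rw [h']

/-- **Theorem 5.6 (cylindrical decomposition adapted to a finite set of polynomials), over the
coefficient ring `k`.** For every finite `Q ⊆ k[X₁, …, Xₙ]` there is a cylindrical decomposition
of `ℝⁿ` with `k`-semialgebraic cells and sections on each cell of which every member of `Q` has
constant sign (`Q`-invariant cells, Def. 5.5). Induction on `n` as printed (p. 214), the
elimination family `Elim_{Xₙ}(Q)` being replaced by the coefficients of a finite stable family
containing `Q` (Cohen–Hörmander elimination, `SignDiagram.exists_isStable_supset`) and Thm. 5.16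
by `exists_isCylindricalDecomposition_succ`. [cite: BasuPollackRoy2006, Thm. 5.6] -/
theorem exists_isCylindricalDecomposition_forall_sign_eq (n : ℕ) :
    ∀ Q : Finset (MvPolynomial (Fin n) k),
      ∃ 𝒮 : Finset (Set (Fin n → ℝ)), IsCylindricalDecomposition k n 𝒮 ∧
        ∀ S ∈ 𝒮, ∀ q ∈ Q, ∀ x ∈ S, ∀ y ∈ S,
          SignType.sign (MvPolynomial.aeval x q) = SignType.sign (MvPolynomial.aeval y q) := by
  induction n with
  | zero =>
    intro Q
    refine ⟨{univ}, rfl, ?_⟩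
    intro S _ q _ x _ y _
    rw [Subsingleton.elim x y]
  | succ n ih =>
    intro Q
    classical
    obtain ⟨P, hQP, hP⟩ := SignDiagram.exists_isStable_supset
      (Q.image fun q => MvPolynomial.finSuccEquiv k n (MvPolynomial.rename (finRotate (n + 1)) q))
    obtain ⟨𝒮, h𝒮, hC⟩ := ih (P.biUnion fun f => f.coeffs)
    have hinv : ∀ S ∈ 𝒮, ∀ x ∈ S, ∀ x' ∈ S, ∀ f ∈ P, ∀ i,
        SignType.sign ((φ x) (f.coeff i)) = SignType.sign ((φ x') (f.coeff i)) := by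
      intro S hS x hx x' hx' f hf i
      by_cases h0 : f.coeff i = 0
      · simp [h0]
      · have hc : f.coeff i ∈ P.biUnion fun f => f.coeffs :=
          Finset.mem_biUnion.mpr ⟨f, hf, Polynomial.coeff_mem_coeffs h0⟩
        exact hC S hS _ hc x hx x' hx'
    obtain ⟨𝒯, h𝒯, hsign⟩ := exists_isCylindricalDecomposition_succ h𝒮 hP hinv
    refine ⟨𝒯, h𝒯, fun T hT q hq z hz z' hz' => ?_⟩
    have hq' : MvPolynomial.finSuccEquiv k n (MvPolynomial.rename (finRotate (n + 1)) q) ∈ P :=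
      hQP (Finset.mem_image_of_mem _ hq)
    have := hsign T hT _ hq' z hz z' hz'
    rwa [eval_map_finSuccEquiv_rename_finRotate, eval_map_finSuccEquiv_rename_finRotate] at this

end Existence

end CylindricalDecomposition

section Discharge

variable {k : Type*} [CommRing k] [Algebra k ℝ]

/-- **Corollary 5.7 (cylindrical decomposition adapted to finitely many semialgebraic sets) —
discharge of the named fact `IsSemialgebraic.exists_cylindricalDecomposition`.** For every finite
family `F` of `k`-semialgebraic subsets of `ℝⁿ` there is a cylindrical decomposition of `ℝⁿ` with
`k`-semialgebraic cells and `k`-semialgebraic continuous sections such that every member of `F` is a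
union of cells: write each member by sign conditions on a finite set of polynomials over `k`
(`IsSemialgebraic.exists_eq_setOf_signVec_mem`, Def. 5.5), take a decomposition adapted to the union
`Q` of these sets (`CylindricalDecomposition.exists_isCylindricalDecomposition_forall_sign_eq`,
Thm. 5.6); a `Q`-invariant cell meeting a member of `F` is contained in it.
[cite: BasuPollackRoy2006, Cor. 5.7] -/
theorem IsSemialgebraic.exists_cylindricalDecomposition_holds :
    IsSemialgebraic.exists_cylindricalDecomposition k := by
  classical
  intro n F hF
  choose Q T hQT using fun s : F => (hF s.1 s.2).exists_eq_setOf_signVec_mem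
  obtain ⟨𝒮, h𝒮, hsign⟩ :=
    CylindricalDecomposition.exists_isCylindricalDecomposition_forall_sign_eq (k := k) n
      (Finset.univ.biUnion fun s : F => Q s)
  refine ⟨𝒮, h𝒮, fun s hs => ⟨𝒮.filter fun S => (S ∩ s).Nonempty, Finset.filter_subset _ _, ?_⟩⟩
  apply Set.Subset.antisymm
  · intro x hx
    obtain ⟨S, hS, hxS⟩ := mem_sUnion.mp hx
    rw [Finset.mem_coe, Finset.mem_filter] at hS
    obtain ⟨y, hyS, hys⟩ := hS.2
    have key : ∀ q ∈ Q ⟨s, hs⟩, SignType.sign (MvPolynomial.aeval x q) =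
        SignType.sign (MvPolynomial.aeval y q) := fun q hq =>
      hsign S hS.1 q (Finset.mem_biUnion.mpr ⟨⟨s, hs⟩, Finset.mem_univ _, hq⟩) x hxS y hyS
    have hy' : y ∈ {x | (fun q : Q ⟨s, hs⟩ =>
        SignType.sign (MvPolynomial.aeval x (q : MvPolynomial (Fin n) k))) ∈ T ⟨s, hs⟩} := by
      rw [← hQT ⟨s, hs⟩]; exact hys
    have hx' : x ∈ {x | (fun q : Q ⟨s, hs⟩ =>
        SignType.sign (MvPolynomial.aeval x (q : MvPolynomial (Fin n) k))) ∈ T ⟨s, hs⟩} := by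
      rw [mem_setOf_eq] at hy' ⊢
      have hfun : (fun q : Q ⟨s, hs⟩ =>
          SignType.sign (MvPolynomial.aeval x (q : MvPolynomial (Fin n) k))) =
          fun q : Q ⟨s, hs⟩ => SignType.sign (MvPolynomial.aeval y (q : MvPolynomial (Fin n) k)) :=
        funext fun q => key q q.2
      rw [hfun]
      exact hy'
    rw [← hQT ⟨s, hs⟩] at hx'
    exact hx'
  · intro x hxs
    obtain ⟨S, ⟨hS, hxS⟩, -⟩ := h𝒮.isPartition.2 x
    refine mem_sUnion.mpr ⟨S, ?_, hxS⟩
    rw [Finset.mem_coe, Finset.mem_filter]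
    exact ⟨Finset.mem_coe.mp hS, x, hxS, hxs⟩

end Discharge

end Literature.ModelTheory.ExponentialFields
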